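import Literature.NumberTheory.EllipticCurves.ModularJacobianModTwoMultiplicityOne
import Literature.NumberTheory.EllipticCurves.PeriodHomologyIntersectionPairing
import Literature.Algebra.Module.SocleCosocle
import HarnessLib

/-!
# Multiplicity one for `J₀(N)[𝔪]` in COSOCLE form: `dim_{𝕋/𝔪} H₁(X₀(N), ℤ)/𝔪 = 2` — the Nakayama input
# (Darmon–Diamond–Taylor, Thm. 4.26 and pp. 133–134: «follow from Thm. 4.26 by Nakayama»; Tilouine 1997, Cor. (1)–(3))

Topic `Literature/NumberTheory/EllipticCurves` (next to `ModularJacobianModPMultiplicityOne` / `…ModTwoMultiplicityOne`,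
whose scope lines say: «NO freeness statements (`T_ℓ(J₀(N))_𝔪`, `H₁(X₀(N), ℤ_ℓ)_𝔪` free of rank `2` over `𝕋_𝔪` …); they
follow from Thm. 4.26 by Nakayama and `Λ ⊗ ℚ_ℓ` free of rank `2` … and are left to a proofs file»). THIS is that proofs file
for the first step: from the SOCLE statement `dim_k J₀(N)[𝔪] = 2` (the printed conclusion of Wiles / Buzzard, tree facts
`wiles1995_multiplicityOne`, `buzzard2000_multiplicityOne_gamma0`) and the Hecke-self-adjoint perfect pairing on
`Λ = H₁(X₀(N), ℤ)` (tree fact `periodHomology_exists_heckeSelfAdjoint_perfectPairing`) to the COSOCLE statement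
`dim_k Λ/𝔪Λ = 2`, i.e. `Λ_𝔪` is generated by TWO elements (Nakayama) — the hypothesis under which
`Literature.Algebra.Module.FreenessCriterion` (with the Eichler–Shimura rank count) yields `Λ_𝔪 ≅ 𝕋_𝔪²`, and under which
`Summit…MazurTateCongruenceAtTwoR.ConditionTwo.exists_basis_pair_self_conj` yields the regular basis `(h, c h)` at `ℓ = 2`.
THEOREMS ONLY (no definition, no named fact, no `sorry`); valid for EVERY prime `ℓ` (the case `ℓ = 2` is the point).

WHAT IS PROVED.
* `J0.exists_linearDivMap`: the map `δ_ℓ : Λ → J₀(N)(ℂ)`, `x ↦ [ℓ⁻¹x]` (`J0.divMap` of the sibling, here `𝕋_ℤ`-LINEAR), with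
  kernel exactly `ℓΛ` and image the `ℓ`-torsion `J₀(N)[ℓ] = ℓ⁻¹Λ/Λ` (Darmon–Diamond–Taylor §1.3 p. 27, §4.5 p. 134
  «`T_ℓ(J₀(N))/ℓT_ℓ(J₀(N)) ≅ J₀(N)[ℓ]`»).
* ★ `J0.natCard_torsionBySet_eq_natCard_quotient` / `J0.finrank_torsionBySet_eq_finrank_quotient`: for a prime `ℓ` and a
  maximal `𝔪 ∋ ℓ` of `𝕋_ℤ = HeckeRing0 N 2`, GRANTED the pairing fact, `#J₀(N)[𝔪] = #(Λ/𝔪Λ)` and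
  `dim_{𝕋/𝔪} J₀(N)[𝔪] = dim_{𝕋/𝔪} Λ/𝔪Λ` (`Λ = periodHomologyHecke N` as a `𝕋_ℤ`-module; abstract core
  `Literature.Algebra.Module.SocleCosocle`).
* ★ `finrank_periodHomology_quotient_eq_two_of_buzzard` (`ℓ = 2`, `N` odd) and `…_of_wiles` (`ℓ` odd): the cosocle form of
  the two multiplicity-one facts, `dim_{𝕋/𝔪} Λ/𝔪Λ = 2`, under their printed hypotheses plus the pairing fact.
Bookkeeping: `HeckeRing0.finite_quotient_of_natCast_mem` (`𝕋/𝔪` is finite when `𝔪 ∋ ℓ`), `moduleFinite_int_periodHomologyHecke`,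
`moduleFree_int_periodHomologyHecke` (`Λ` is a finitely generated free `ℤ`-module: the tree's `periodHomology_fg` + torsion-free).
Nothing here asserts the multiplicity-one facts or the pairing fact; BSD is not touched.

References: Darmon–Diamond–Taylor 1995 §1.3 (p. 27), §4.5 Thm. 4.26, pp. 133–134 [DarmonDiamondTaylor1995]; Tilouine 1997
Thm. 3.4, Cor. (1)–(3) [Tilouine1997Gorenstein]; Buzzard 2000 Prop. 2.4 [Buzzard2000LevelLoweringModTwo]; Mazur 1977 §II.14–15
[Mazur1977].
-/

set_option autoImplicit false

noncomputable section

open scoped MatrixGroups ModularForm NumberField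

open Module Function CongruenceSubgroup Polynomial IsDedekindDomain

namespace Literature.NumberTheory.EllipticCurves.ModularForms

section Lattice

variable (N : ℕ) [NeZero N]

/-- `Λ = H₁(X₀(N), ℤ)` (as the `𝕋_ℤ`-module `periodHomologyHecke N`) is a finitely generated `ℤ`-module (the tree's
`periodHomology_fg`; Darmon–Diamond–Taylor §1.3 p. 27: «a `ℤ`-module of rank `2g`»). [cite: DarmonDiamondTaylor1995, §1.3 (p. 27)] -/
theorem moduleFinite_int_periodHomologyHecke : Module.Finite ℤ (periodHomologyHecke N) := by
  have h := (AddGroup.fg_iff_addSubgroup_fg (periodHomology N)).mpr periodHomology_fg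
  exact Module.Finite.iff_addGroup_fg.mpr h

/-- `Λ = H₁(X₀(N), ℤ)` is a free `ℤ`-module (finitely generated and torsion-free inside the `ℂ`-vector space `S₂^∨`).
[cite: DarmonDiamondTaylor1995, §1.3 (p. 27)] -/
theorem moduleFree_int_periodHomologyHecke : Module.Free ℤ (periodHomologyHecke N) := by
  haveI := moduleFinite_int_periodHomologyHecke N
  exact Module.free_of_finite_type_torsion_free'

/-- `𝕋_ℤ/𝔪` is finite for an ideal `𝔪` containing a nonzero integer `ℓ` (`𝕋_ℤ` is a finitely generated `ℤ`-module,
Darmon–Diamond–Taylor §4.1 p. 107, and `𝕋/𝔪` is a quotient of `𝕋/ℓ𝕋`). [cite: DarmonDiamondTaylor1995, §4.1 (p. 107)] -/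
theorem HeckeRing0.finite_quotient_of_natCast_mem {𝔪 : Ideal (HeckeRing0 N 2)} {ℓ : ℕ} (hℓ : ℓ ≠ 0)
    (h𝔪 : (ℓ : HeckeRing0 N 2) ∈ 𝔪) : Finite (HeckeRing0 N 2 ⧸ 𝔪) := by
  haveI : Module.Finite ℤ (HeckeRing0 N 2 ⧸ 𝔪) :=
    Module.Finite.of_surjective (Ideal.Quotient.mk 𝔪).toAddMonoidHom.toIntLinearMap Ideal.Quotient.mk_surjective
  refine Module.finite_of_fg_torsion (HeckeRing0 N 2 ⧸ 𝔪) fun x ↦ ?_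
  refine ⟨⟨(ℓ : ℤ), mem_nonZeroDivisors_of_ne_zero (by exact_mod_cast hℓ)⟩, ?_⟩
  obtain ⟨t, rfl⟩ := Ideal.Quotient.mk_surjective x
  change (ℓ : ℤ) • Ideal.Quotient.mk 𝔪 t = 0
  rw [natCast_zsmul, ← map_nsmul, Ideal.Quotient.eq_zero_iff_mem, nsmul_eq_mul]
  exact 𝔪.mul_mem_right _ h𝔪

/-- **The `𝕋_ℤ`-linear map `δ_ℓ : Λ → J₀(N)(ℂ) = S₂^∨/Λ`, `x ↦ [ℓ⁻¹ x]`** (`ℓ ≠ 0`): it is Hecke-linear, its kernel is exactly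
`ℓΛ`, and its image is the `ℓ`-torsion `J₀(N)[ℓ] = ℓ⁻¹Λ/Λ` — «`T_ℓ(J₀(N))/ℓ T_ℓ(J₀(N)) ≅ J₀(N)[ℓ]`», i.e. `Λ/ℓΛ ≅ J₀(N)[ℓ]`
Hecke-equivariantly (same map as the sibling's additive `J0.divMap`). [cite: DarmonDiamondTaylor1995, §1.3 (p. 27) and §4.5 (p. 134)] -/
theorem J0.exists_linearDivMap {ℓ : ℕ} (hℓ : ℓ ≠ 0) :
    ∃ δ : periodHomologyHecke N →ₗ[HeckeRing0 N 2] J0 N,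
      (∀ x : periodHomologyHecke N,
          δ x = Submodule.Quotient.mk ((ℓ : ℂ)⁻¹ • (x : Module.Dual ℂ (CuspForm (Gamma0 N) 2)))) ∧
      (∀ x : periodHomologyHecke N, δ x = 0 ↔ ∃ z : periodHomologyHecke N, x = ℓ • z) ∧
      (∀ p ∈ Submodule.torsionBy (HeckeRing0 N 2) (J0 N) ℓ, ∃ x : periodHomologyHecke N, δ x = p) := by
  have hℓ' : (ℓ : ℂ) ≠ 0 := Nat.cast_ne_zero.mpr hℓ
  let δ : periodHomologyHecke N →ₗ[HeckeRing0 N 2] J0 N :=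
    { toFun := fun x ↦ Submodule.Quotient.mk ((ℓ : ℂ)⁻¹ • (x : Module.Dual ℂ (CuspForm (Gamma0 N) 2)))
      map_add' := fun x y ↦ by
        simp only [Submodule.coe_add, smul_add, Submodule.Quotient.mk_add]
      map_smul' := fun t x ↦ by
        have hc : (ℓ : ℂ)⁻¹ • ((t • x : periodHomologyHecke N) : Module.Dual ℂ (CuspForm (Gamma0 N) 2)) =
            t • ((ℓ : ℂ)⁻¹ • (x : Module.Dual ℂ (CuspForm (Gamma0 N) 2))) := by
          rw [Submodule.coe_smul]
          ext f
          simp [HeckeRing0.smul_dual_apply]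
        simp only [RingHom.id_apply, hc, Submodule.Quotient.mk_smul] }
  refine ⟨δ, fun x ↦ rfl, fun x ↦ ?_, fun p hp ↦ ?_⟩
  · change Submodule.Quotient.mk _ = (0 : J0 N) ↔ _
    rw [Submodule.Quotient.mk_eq_zero]
    constructor
    · intro h
      refine ⟨⟨_, h⟩, Subtype.ext ?_⟩
      show (x : Module.Dual ℂ (CuspForm (Gamma0 N) 2)) =
        ((ℓ • (⟨_, h⟩ : periodHomologyHecke N) : periodHomologyHecke N) : Module.Dual ℂ (CuspForm (Gamma0 N) 2))
      rw [Submodule.coe_smul_of_tower]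
      show (x : Module.Dual ℂ (CuspForm (Gamma0 N) 2)) = ℓ • ((ℓ : ℂ)⁻¹ • (x : Module.Dual ℂ (CuspForm (Gamma0 N) 2)))
      rw [← Nat.cast_smul_eq_nsmul ℂ, smul_smul, mul_inv_cancel₀ hℓ', one_smul]
    · rintro ⟨z, rfl⟩
      rw [Submodule.coe_smul_of_tower, ← Nat.cast_smul_eq_nsmul ℂ, smul_smul, inv_mul_cancel₀ hℓ', one_smul]
      exact z.2
  · obtain ⟨y, hy⟩ := J0.mem_range_divMap N hℓ hp
    exact ⟨⟨(y : Module.Dual ℂ (CuspForm (Gamma0 N) 2)), y.2⟩, hy⟩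

end Lattice

section Cosocle

variable (N : ℕ) [NeZero N]

/-- **`#J₀(N)[𝔪] = #(Λ/𝔪Λ)`** for a prime `ℓ` and an ideal `𝔪 ∋ ℓ` of `𝕋_ℤ`, granted the Hecke-self-adjoint perfect
pairing on `Λ = H₁(X₀(N), ℤ)`: the `𝔪`-torsion of the Jacobian (SOCLE side) and the `𝔪`-co-invariants of the period
homology (COSOCLE side) have the same size. [cite: DarmonDiamondTaylor1995, §4.5 Thm. 4.26 and pp. 133–134; proved here from the pairing] -/
theorem J0.natCard_torsionBySet_eq_natCard_quotient
    (hpair : periodHomology_exists_heckeSelfAdjoint_perfectPairing) (ℓ : ℕ) [Fact ℓ.Prime]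
    (𝔪 : Ideal (HeckeRing0 N 2)) (h𝔪 : (ℓ : HeckeRing0 N 2) ∈ 𝔪) :
    Nat.card (Submodule.torsionBySet (HeckeRing0 N 2) (J0 N) 𝔪) =
      Nat.card (periodHomologyHecke N ⧸ 𝔪 • (⊤ : Submodule (HeckeRing0 N 2) (periodHomologyHecke N))) := by
  have hℓ : ℓ ≠ 0 := (Fact.out : ℓ.Prime).ne_zero
  haveI := moduleFinite_int_periodHomologyHecke N
  haveI := moduleFree_int_periodHomologyHecke N
  obtain ⟨B, hB, hadj⟩ := hpair N
  obtain ⟨δ, -, hker, hrange⟩ := J0.exists_linearDivMap N hℓ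
  exact Literature.Algebra.Module.SocleCosocle.natCard_torsionBySet_eq_natCard_quotient B hB hadj ℓ 𝔪 h𝔪 δ hker
    fun p hp ↦ hrange p (J0.torsionBySet_le_torsionBy N h𝔪 hp)

/-- **Socle = cosocle for `J₀(N)`: `dim_{𝕋/𝔪} J₀(N)[𝔪] = dim_{𝕋/𝔪} Λ/𝔪Λ`** for a prime `ℓ` and a maximal `𝔪 ∋ ℓ` of
`𝕋_ℤ`, granted the Hecke-self-adjoint perfect pairing on `Λ = H₁(X₀(N), ℤ)` — the passage «`dim J₀(N)[𝔪] =
dim (T_ℓ J₀(N)/𝔪)`» of Darmon–Diamond–Taylor Thm. 4.26 / p. 134, valid for EVERY `ℓ` (including `2`).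
[cite: DarmonDiamondTaylor1995, §4.5 Thm. 4.26 and pp. 133–134; proved here from the pairing] [cite: Tilouine1997Gorenstein, Thm. 3.4, Cor. (1)–(3)] -/
theorem J0.finrank_torsionBySet_eq_finrank_quotient
    (hpair : periodHomology_exists_heckeSelfAdjoint_perfectPairing) (ℓ : ℕ) [Fact ℓ.Prime]
    (𝔪 : Ideal (HeckeRing0 N 2)) [𝔪.IsMaximal] (h𝔪 : (ℓ : HeckeRing0 N 2) ∈ 𝔪) :
    Module.finrank (HeckeRing0 N 2 ⧸ 𝔪) (Submodule.torsionBySet (HeckeRing0 N 2) (J0 N) 𝔪) =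
      Module.finrank (HeckeRing0 N 2 ⧸ 𝔪)
        (periodHomologyHecke N ⧸ 𝔪 • (⊤ : Submodule (HeckeRing0 N 2) (periodHomologyHecke N))) := by
  have hℓ : ℓ ≠ 0 := (Fact.out : ℓ.Prime).ne_zero
  haveI := moduleFinite_int_periodHomologyHecke N
  haveI := moduleFree_int_periodHomologyHecke N
  haveI := HeckeRing0.finite_quotient_of_natCast_mem N hℓ h𝔪
  haveI := J0.finite_torsionBySet N hℓ h𝔪
  obtain ⟨B, hB, hadj⟩ := hpair N
  obtain ⟨δ, -, hker, hrange⟩ := J0.exists_linearDivMap N hℓ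
  exact Literature.Algebra.Module.SocleCosocle.finrank_torsionBySet_eq_finrank_quotient B hB hadj ℓ 𝔪 h𝔪 δ hker
    fun p hp ↦ hrange p (J0.torsionBySet_le_torsionBy N h𝔪 hp)

end Cosocle

section MultiplicityOne

open GaloisRepresentations Rat.HeightOneSpectrum

/-- **Mod `2` multiplicity one in COSOCLE form** (`N` odd): under the hypotheses of Buzzard's Prop. 2.4 as typed in
`buzzard2000_multiplicityOne_gamma0` (`𝔪 ∋ 2` maximal in `𝕋_ℤ`, `ρ ≅ ρ_𝔪` over an algebraically closed `k`, irreducible and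
non-scalar on a decomposition group at `2`), and granted that fact and the pairing fact, the period homology satisfies
`dim_{𝕋/𝔪} H₁(X₀(N), ℤ)/𝔪 = 2`: `Λ_𝔪` is generated by two elements. [cite: Buzzard2000LevelLoweringModTwo, Prop. 2.4 and Def. 2.1–2.2 (p. 100–101)]
[cite: DarmonDiamondTaylor1995, §4.5 (pp. 133–134)] -/
theorem finrank_periodHomology_quotient_eq_two_of_buzzard (hmult : buzzard2000_multiplicityOne_gamma0)
    (hpair : periodHomology_exists_heckeSelfAdjoint_perfectPairing)
    (N : ℕ) [NeZero N] (hN : Odd N) (𝔪 : Ideal (HeckeRing0 N 2)) [h𝔪 : 𝔪.IsMaximal] (h2 : (2 : HeckeRing0 N 2) ∈ 𝔪)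
    (k : Type) [Field k] [IsAlgClosed k] [TopologicalSpace k] [DiscreteTopology k]
    (ι : HeckeRing0 N 2 ⧸ 𝔪 →+* k) (ρ : ModPGaloisRep ℚ k 2)
    (hρ : ∀ v : HeightOneSpectrum (𝓞 ℚ), ¬ ((primesEquiv v : Nat.Primes) : ℕ) ∣ 2 * N →
      ρ.IsUnramifiedAt v ∧
        ρ.HasFrobCharpolyAt v
          (X ^ 2
            - C (ι (Ideal.Quotient.mk 𝔪 (HeckeRing0.T N 2
                ((primesEquiv v : Nat.Primes) : ℕ) (primesEquiv v : Nat.Primes).2))) * X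
            + C (((primesEquiv v : Nat.Primes) : ℕ) : k)))
    (hirr : FramedRep.IsIrreducible ρ)
    (hns : ∀ v : HeightOneSpectrum (𝓞 ℚ), ((primesEquiv v : Nat.Primes) : ℕ) = 2 →
      ∀ 𝔓 ∈ v.primesAbove, ∃ σ ∈ 𝔓.decompositionSubgroup (Field.absoluteGaloisGroup ℚ),
        ∀ c : k, ((ρ σ : GL (Fin 2) k) : Matrix (Fin 2) (Fin 2) k) ≠ Matrix.scalar (Fin 2) c) :
    Module.finrank (HeckeRing0 N 2 ⧸ 𝔪)
        (periodHomologyHecke N ⧸ 𝔪 • (⊤ : Submodule (HeckeRing0 N 2) (periodHomologyHecke N))) = 2 := by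
  haveI : Fact (Nat.Prime 2) := ⟨Nat.prime_two⟩
  have h := hmult N hN 𝔪 h𝔪 h2 k ι ρ hρ hirr hns
  rw [← J0.finrank_torsionBySet_eq_finrank_quotient N hpair 2 𝔪 (by exact_mod_cast h2)]
  exact h

/-- **Mod `ℓ` multiplicity one in COSOCLE form, `ℓ` odd**: under the hypotheses of Darmon–Diamond–Taylor Thm. 4.26 as
typed in `wiles1995_multiplicityOne`, and granted that fact and the pairing fact, `dim_{𝕋/𝔪} H₁(X₀(N), ℤ)/𝔪 = 2`.
(For odd `ℓ` the second conjunct of the fact, `dim (J₀(N)[ℓ]/𝔪) = 2`, gives this also without the pairing, through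
`Λ/ℓΛ ≅ J₀(N)[ℓ]`; the pairing road is recorded for uniformity with `ℓ = 2`.)
[cite: DarmonDiamondTaylor1995, Thm. 4.26 (§4.5, p. 134) and pp. 133–134] -/
theorem finrank_periodHomology_quotient_eq_two_of_wiles (hmult : wiles1995_multiplicityOne)
    (hpair : periodHomology_exists_heckeSelfAdjoint_perfectPairing)
    (N : ℕ) [NeZero N] (ℓ : ℕ) [Fact ℓ.Prime] (hℓ2 : ℓ ≠ 2) (𝔪 : Ideal (HeckeRing0 N 2)) [h𝔪 : 𝔪.IsMaximal]
    (hℓ : (ℓ : HeckeRing0 N 2) ∈ 𝔪)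
    (k : Type) [Field k] [TopologicalSpace k] [DiscreteTopology k]
    (ι : HeckeRing0 N 2 ⧸ 𝔪 →+* k) (ρ : ModPGaloisRep ℚ k 2)
    (hρ : ∀ v : HeightOneSpectrum (𝓞 ℚ), ¬ ((primesEquiv v : Nat.Primes) : ℕ) ∣ N * ℓ →
      ρ.IsUnramifiedAt v ∧
        ρ.HasFrobCharpolyAt v
          (X ^ 2
            - C (ι (Ideal.Quotient.mk 𝔪 (HeckeRing0.T N 2
                ((primesEquiv v : Nat.Primes) : ℕ) (primesEquiv v : Nat.Primes).2))) * X
            + C (((primesEquiv v : Nat.Primes) : ℕ) : k)))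
    (hirr : FramedRep.IsIrreducible ρ) (hlev : ¬ ℓ ∣ N ∨ (¬ ℓ ^ 2 ∣ N ∧ HeckeRing0.T N 2 ℓ Fact.out ∉ 𝔪)) :
    Module.finrank (HeckeRing0 N 2 ⧸ 𝔪)
        (periodHomologyHecke N ⧸ 𝔪 • (⊤ : Submodule (HeckeRing0 N 2) (periodHomologyHecke N))) = 2 := by
  have h := (hmult N ℓ hℓ2 𝔪 h𝔪 hℓ k ι ρ hρ hirr hlev).1
  rw [← J0.finrank_torsionBySet_eq_finrank_quotient N hpair ℓ 𝔪 hℓ]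
  exact h

end MultiplicityOne

end Literature.NumberTheory.EllipticCurves.ModularForms

end
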